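import Literature.AlgebraicGeometry.Resolution.LocalBlowup
import Mathlib.RingTheory.Adjoin.Basic
import HarnessLib

/-!
# Route `HomologicalConductor`, crux `Globalisation` (stmt-ResolutionOfSingularities-16486), line `birth_HomologicalConductor` (v2) — stub `stub_locEq`

The route's `loc B = k[{a * s⁻¹ | a, s ∈ B, s⁻¹ ∈ O}]` (the `k`-subalgebra of `K` generated by the
fractions of `B` whose denominator is an `O`-unit or zero) has, for `B ⊆ O`, the same underlying
subring as the tree's `locAtCentre B.toSubring O = {y / z | y, z ∈ B, O.valuation z = 1}`
(`Literature/AlgebraicGeometry/Resolution/LocalBlowup.lean`).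

Proof: a generator `a * s⁻¹` with `s ∈ B ⊆ O` and `s⁻¹ ∈ O` is `0` (if `s = 0`) or has
`O.valuation s = 1`, so it lies in the subring `locAtCentre B.toSubring O`, which contains `B`
(hence the constants); conversely `y / z = y * z⁻¹` with `O.valuation z = 1` has `z⁻¹ ∈ O`, so it
is a generator.
-/

-- single-problem summit: the doubled namespace component `ResolutionOfSingularities` is forced
set_option linter.dupNamespace false

namespace Summit.ResolutionOfSingularities.ResolutionOfSingularities.Theorems.HomologicalConductorGlobalisation

open Literature.AlgebraicGeometry.Resolution

/-- For `s ≠ 0` in a valuation ring `O` of `K`: `s⁻¹ ∈ O` iff `O.valuation s = 1`. [folklore] -/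
private theorem inv_mem_iff_valuation_eq_one {K : Type} [Field K] (O : ValuationSubring K)
    {s : K} (hs : s ∈ O) (hs0 : s ≠ 0) : s⁻¹ ∈ O ↔ O.valuation s = 1 := by
  -- adapted from `risoGlob_inv_mem_valuationSubring_iff`
  -- (Theorems/RisoStrataRisoGlobalisationCentres.lean)
  rw [← O.valuation_le_one_iff, map_inv₀]
  have hv0 : O.valuation s ≠ 0 := by rwa [Ne, map_eq_zero]
  have hle : O.valuation s ≤ 1 := (O.valuation_le_one_iff s).mpr hs
  rw [inv_le_one₀ (zero_lt_iff.mpr hv0)]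
  exact ⟨fun h => le_antisymm hle h, fun h => h.ge⟩

/-- **The route's `loc` is `locAtCentre`.** For a `k`-subalgebra `B ⊆ O` of `K`, the subring
underlying `k[{a * s⁻¹ | a, s ∈ B, s⁻¹ ∈ O}]` is `locAtCentre B.toSubring O`, i.e. `B` localised
at the centre `𝔪_O ∩ B` of `O`, read inside `K`. [cite: NovacoskiSpivakovsky2014, Def. 2.8] -/
theorem stub_locEq {k K : Type} [Field k] [Field K] [Algebra k K] (O : ValuationSubring K)
    (B : Subalgebra k K) (hBO : B.toSubring ≤ O.toSubring) :
    (Algebra.adjoin k {y : K | ∃ a ∈ B, ∃ s ∈ B, s⁻¹ ∈ O ∧ y = a * s⁻¹}).toSubring =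
      Literature.AlgebraicGeometry.Resolution.locAtCentre B.toSubring O := by
  -- adapted from `coe_risoLoc_eq_locAtCentre` (Theorems/RisoStrataRisoGlobalisationCentres.lean)
  -- `locAtCentre B.toSubring O` as a `k`-subalgebra (it contains `B`, hence the constants).
  let L : Subalgebra k K :=
    { locAtCentre B.toSubring O with
      algebraMap_mem' := fun c => le_locAtCentre _ O (B.algebraMap_mem c) }
  apply le_antisymm
  · have hle : Algebra.adjoin k {y : K | ∃ a ∈ B, ∃ s ∈ B, s⁻¹ ∈ O ∧ y = a * s⁻¹} ≤ L := by
      refine Algebra.adjoin_le ?_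
      rintro _ ⟨a, ha, s, hs, hsO, rfl⟩
      change a * s⁻¹ ∈ locAtCentre B.toSubring O
      by_cases hs0 : s = 0
      · rw [hs0, inv_zero, mul_zero]; exact Subring.zero_mem _
      · exact mem_locAtCentre_iff.mpr ⟨a, ha, s, hs,
          (inv_mem_iff_valuation_eq_one O (hBO hs) hs0).mp hsO, by rw [div_eq_mul_inv]⟩
    intro x hx
    exact hle hx
  · rintro x ⟨a, ha, s, hs, hv, rfl⟩
    have hs0 : (s : K) ≠ 0 := ne_zero_of_valuation_eq_one hv
    change a / s ∈ Algebra.adjoin k {y : K | ∃ a ∈ B, ∃ s ∈ B, s⁻¹ ∈ O ∧ y = a * s⁻¹}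
    rw [div_eq_mul_inv]
    exact Algebra.subset_adjoin ⟨a, ha, s, hs,
      (inv_mem_iff_valuation_eq_one O (hBO hs) hs0).mpr hv, rfl⟩

end Summit.ResolutionOfSingularities.ResolutionOfSingularities.Theorems.HomologicalConductorGlobalisation
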